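import Summits.MatrixMultiplication.MatrixMultiplication.Theses.AsymptoticRankCW
import Literature.Computability.AlgebraicComplexity.CoppersmithWinograd1990Proofs

/-!
# Route AsymptoticRankCW — support item `GlueRecordOmega` (stmt-MatrixMultiplication-1886)

`BRecordThreshold → ω(ℂ) < 2.36`: if the Kronecker powers of the small Coppersmith–Winograd tensor
`T_cw,2` have rank `O((13/4)^{(1+ε)N})` for every `ε > 0` (i.e. `R̃(T_cw,2) ≤ 13/4`), then the PROVED
Coppersmith–Winograd 1990 "easy" laser bound in asymptotic-rank form
(`CoppersmithWinograd1990_asymptoticRank_form_holds`, with `q = 2`, `ρ = 13/4`) gives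
`ω(ℂ) ≤ log₂(4·(13/4)³/27) = log₂(2197/432) = 2.3465… < 2.36` — below the current record `2.371339`.
The only new content is the numerics `2197/432 < 2^{2.36}`.
-/

noncomputable section

set_option linter.dupNamespace false

namespace Summit.MatrixMultiplication.MatrixMultiplication.Theorems

open Literature.Computability.AlgebraicComplexity
open Summit.MatrixMultiplication.MatrixMultiplication.Theses.AsymptoticRankCW

/-- Numerics of the record milestone: `4·(13/4)³/27 = 2197/432 = 5.0856… < 5.13… = 2^{2.36}`, via
`2^{2.36} = 4·e^{0.36 log 2} ≥ 4(1 + x + x²/2)` with `x = 0.36 log 2` and `log 2 > 0.6931471803`.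
[folklore] -/
theorem glueRecordOmega_numerics :
    (4 : ℝ) * ((13 : ℝ) / 4) ^ 3 / 27 < (2 : ℝ) ^ (2.36 : ℝ) := by
  have hlog2 := Real.log_two_gt_d9
  have h2 : (2 : ℝ) ^ (2.36 : ℝ) = (2 : ℝ) ^ (2 : ℕ) * Real.exp (Real.log 2 * 0.36) := by
    rw [← Real.rpow_def_of_pos (by norm_num : (0 : ℝ) < 2), ← Real.rpow_natCast (2 : ℝ) 2,
      ← Real.rpow_add (by norm_num : (0 : ℝ) < 2)]
    norm_num
  have hx0 : (0 : ℝ) ≤ Real.log 2 * 0.36 := by positivity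
  have hexp : 1 + Real.log 2 * 0.36 + (Real.log 2 * 0.36) ^ 2 / 2 ≤ Real.exp (Real.log 2 * 0.36) :=
    Real.quadratic_le_exp_of_nonneg hx0
  rw [h2]
  have h4 : (2 : ℝ) ^ (2 : ℕ) = 4 := by norm_num
  rw [h4]
  nlinarith

/-- **Support item `GlueRecordOmega` (stmt-MatrixMultiplication-1886)**: the record threshold
`R̃(T_cw,2) ≤ 13/4` (crux `BRecordThreshold`, growth form) forces `ω(ℂ) < 2.36`, through the proved
Coppersmith–Winograd 1990 asymptotic-rank bound `ω(ℂ) ≤ log₂(4ρ³/27)` at `ρ = 13/4` and the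
numerics `log₂(2197/432) < 2.36`. -/
theorem glueRecordOmega_proof : GlueRecordOmega := by
  unfold GlueRecordOmega
  intro hX
  have h := CoppersmithWinograd1990_asymptoticRank_form_holds 2 le_rfl ((13 : ℝ) / 4)
    (by norm_num) hX
  have hpos : (0 : ℝ) < 4 * ((13 : ℝ) / 4) ^ 3 / 27 := by positivity
  have hlt : Real.logb ((2 : ℕ) : ℝ) (4 * ((13 : ℝ) / 4) ^ 3 / 27) < 2.36 := by
    rw [Nat.cast_ofNat, Real.logb_lt_iff_lt_rpow (by norm_num) hpos]
    exact glueRecordOmega_numerics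
  exact h.trans_lt hlt

end Summit.MatrixMultiplication.MatrixMultiplication.Theorems

end
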